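import Summits.QuantumFields.YangMills.Theorems.IR.ColdDefectFiniteAbelian
import HarnessLib

/-!
# THE NUMBER's currency at a finite ABELIAN gauge group: exact SECTOR–FLUCTUATION factorisation (helper for stmt-QuantumFields-26930)

Sequel of `FlatConnectionCount` (p784178, `#Flat = |G|^{V+3}`) and `ColdDefectFiniteAbelian` (p784277, `δᶜ_β(L) → 1 − |G|⁻³`); LEAD prover
`ymfull-r2c-lead-1` g0, cell `ym-gapexp`, `--supports stmt-QuantumFields-26930`.  For a finite ABELIAN gauge group the Wilson weight depends on
the gauge field only through its plaquette field, and the plaquette-field map is a homomorphism whose fibres are cosets of the flat subgroup;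
hence at EVERY coupling `β` (not only at `β = ∞`):

* `sum_comp_plaquetteField_eq` — `∑_U f(P U) = #Flat · ∑_{ω ∈ P(univ)} f(ω)` (fibres of the plaquette-field hom are flat cosets);
* `wilsonFinTorusPartition_eq_flat_mul_fluct` — **`Z_β(Λ) = Haar(Flat(Λ)) · Ξ_β(Λ)`**, where the FLUCTUATION SUM `Ξ_β(Λ) = ∑_{ω ∈ P(univ)} e^{−β S(ω)}`
  runs over the achievable plaquette fields (written inline; def-free);
* `coldDefect_eq_sector_mul_fluct` — **`coldDefect ρ β L = 1 − |G|⁻³ · Ξ_β(L³×2⌊L/4⌋) / Ξ_β(L³×⌊L/4⌋)²`** for `L ≥ 4`: THE NUMBER's currency at a finite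
  abelian group is the 't Hooft SECTOR factor `|G|⁻³` times a FLUCTUATION ratio (`→ 1` as `β → ∞` at fixed box, p784277; its volume-UNIFORM control
  `|log Ξ(L³×2t) − 2 log Ξ(L³×t)| ≪ 1` at fixed large `β` is exactly the torus-doubling estimate of a convergent surface-gas expansion — the tree's
  abstract `ClusterExpansionCovering.norm_polymerLogZ_timeCover_sub_mul_le`, p708064 — and is the open interface to a volume-uniform impurity
  theorem, memo `Cruxes/IRcof/CONSUMERS-CENSUS-ymfull-r2c-lead-1-g0.md` §G.1).

HONEST FRAMING: finite-group calibration on the BC5 side of the crux `IRcof`; nothing here proves `PinnedExitsCofinalAt`, `IRcof`, `IR`, or the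
Yang–Mills mass gap.  Def-free.  Reference: 't Hooft 1979 (flux sectors); the factorisation is lattice folklore (plaquette-field change of variables,
cf. Forsström–Lenells–Viklund 2022 §2.3 for finite abelian gauge groups; tree `FiniteGaugeGroupTorus.sum_comp_plaqField` for the isotropic torus).
-/

set_option autoImplicit false

noncomputable section

open Filter Topology MeasureTheory
open Literature.MathematicalPhysics.QuantumFieldTheory Literature.MathematicalPhysics.QuantumLattice
open Summit.QuantumFields.YangMills.Cruxes.IR.ColdPurityBridge (coldDefect)

namespace Summit.QuantumFields.YangMills.Cruxes.IR.FreezingLimit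

/-! ## §1 Fibres of the plaquette-field homomorphism are flat cosets -/

section Fibres

variable {G : Type} [CommGroup G] [Fintype G] [DecidableEq G] {n₀ n₁ n₂ n₃ : ℕ}
  [DecidableEq (FinTorusSite n₀ n₁ n₂ n₃ × {q : Fin 4 × Fin 4 // q.1 < q.2} → G)]

omit [Fintype G] [DecidableEq G] [DecidableEq (FinTorusSite n₀ n₁ n₂ n₃ × {q : Fin 4 × Fin 4 // q.1 < q.2} → G)] in
/-- For an abelian gauge group, two gauge fields have the same plaquette field (on the positively oriented plaquettes) iff their quotient
is flat. -/
theorem plaquetteField_eq_iff_div_flat (U V : FinTorusSite n₀ n₁ n₂ n₃ × Fin 4 → G) :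
    (fun p : FinTorusSite n₀ n₁ n₂ n₃ × {q : Fin 4 × Fin 4 // q.1 < q.2} => finTorusPlaquette U p.1 p.2.1.1 p.2.1.2) =
      (fun p : FinTorusSite n₀ n₁ n₂ n₃ × {q : Fin 4 × Fin 4 // q.1 < q.2} => finTorusPlaquette V p.1 p.2.1.1 p.2.1.2) ↔
    ∀ (x : FinTorusSite n₀ n₁ n₂ n₃) (q : {q : Fin 4 × Fin 4 // q.1 < q.2}), finTorusPlaquette (U / V) x q.1.1 q.1.2 = 1 := by
  constructor
  · intro h x q
    have hx := congrFun h (x, q)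
    simp only at hx
    rw [div_eq_mul_inv, finTorusPlaquette_mul, finTorusPlaquette_inv, hx, mul_inv_cancel]
  · intro h
    funext p
    have hp := h p.1 p.2
    rw [div_eq_mul_inv, finTorusPlaquette_mul, finTorusPlaquette_inv, mul_inv_eq_one] at hp
    exact hp

/-- **Every fibre of the plaquette-field map has the cardinality of the flat set** (it is a coset of the flat subgroup). -/
theorem card_fibre_plaquetteField (V : FinTorusSite n₀ n₁ n₂ n₃ × Fin 4 → G) :
    (Finset.univ.filter fun U : FinTorusSite n₀ n₁ n₂ n₃ × Fin 4 → G =>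
        (fun p : FinTorusSite n₀ n₁ n₂ n₃ × {q : Fin 4 × Fin 4 // q.1 < q.2} => finTorusPlaquette U p.1 p.2.1.1 p.2.1.2) =
        (fun p : FinTorusSite n₀ n₁ n₂ n₃ × {q : Fin 4 × Fin 4 // q.1 < q.2} => finTorusPlaquette V p.1 p.2.1.1 p.2.1.2)).card =
      (Finset.univ.filter fun W : FinTorusSite n₀ n₁ n₂ n₃ × Fin 4 → G =>
        ∀ (x : FinTorusSite n₀ n₁ n₂ n₃) (q : {q : Fin 4 × Fin 4 // q.1 < q.2}), finTorusPlaquette W x q.1.1 q.1.2 = 1).card := by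
  refine Finset.card_bij (fun U _ => U / V) (fun U hU => ?_) (fun U₁ _ U₂ _ h => ?_) (fun W hW => ?_)
  · rw [Finset.mem_filter] at hU ⊢
    exact ⟨Finset.mem_univ _, (plaquetteField_eq_iff_div_flat U V).1 hU.2⟩
  · exact div_left_injective h
  · refine ⟨W * V, ?_, mul_div_cancel_right W V⟩
    rw [Finset.mem_filter] at hW ⊢
    refine ⟨Finset.mem_univ _, (plaquetteField_eq_iff_div_flat (W * V) V).2 ?_⟩
    rw [mul_div_cancel_right]
    exact hW.2

/-- **Fibre identity**: for any weight `f` of the plaquette field, `∑_U f(P U) = #Flat · ∑_{ω ∈ P(univ)} f ω`. -/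
theorem sum_comp_plaquetteField_eq
    (f : (FinTorusSite n₀ n₁ n₂ n₃ × {q : Fin 4 × Fin 4 // q.1 < q.2} → G) → ℝ) :
    ∑ U : FinTorusSite n₀ n₁ n₂ n₃ × Fin 4 → G,
        f (fun p : FinTorusSite n₀ n₁ n₂ n₃ × {q : Fin 4 × Fin 4 // q.1 < q.2} => finTorusPlaquette U p.1 p.2.1.1 p.2.1.2) =
      (Finset.univ.filter fun W : FinTorusSite n₀ n₁ n₂ n₃ × Fin 4 → G =>
          ∀ (x : FinTorusSite n₀ n₁ n₂ n₃) (q : {q : Fin 4 × Fin 4 // q.1 < q.2}), finTorusPlaquette W x q.1.1 q.1.2 = 1).card *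
        ∑ ω ∈ Finset.univ.image (fun U : FinTorusSite n₀ n₁ n₂ n₃ × Fin 4 → G =>
            fun p : FinTorusSite n₀ n₁ n₂ n₃ × {q : Fin 4 × Fin 4 // q.1 < q.2} => finTorusPlaquette U p.1 p.2.1.1 p.2.1.2), f ω := by
  rw [Finset.sum_comp, Finset.mul_sum]
  refine Finset.sum_congr rfl fun ω hω => ?_
  obtain ⟨V, -, hV⟩ := Finset.mem_image.1 hω
  subst hV
  rw [nsmul_eq_mul]
  congr 1
  have h := card_fibre_plaquetteField (n₀ := n₀) (n₁ := n₁) (n₂ := n₂) (n₃ := n₃) V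
  convert congrArg (fun k : ℕ => (k : ℝ)) h using 3

end Fibres

/-! ## §2 `Z_β = Haar(Flat) · Ξ_β` -/

section Factorisation

variable {G : Type} [CommGroup G] [Fintype G] [DecidableEq G] [TopologicalSpace G] [DiscreteTopology G] [IsTopologicalGroup G]
  [CompactSpace G] [MeasurableSpace G] [BorelSpace G]
variable {n : ℕ} (ρ : G →* Matrix (Fin n) (Fin n) ℂ) (hρ : ∀ g, (ρ g).trace.re = n ↔ g = 1)
include hρ

omit [Fintype G] [DecidableEq G] [TopologicalSpace G] [DiscreteTopology G] [IsTopologicalGroup G] [CompactSpace G] [MeasurableSpace G]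
  [BorelSpace G] hρ in
/-- `1 − P₂B/(P₁A)² = 1 − (P₂/P₁²)·(B/A²)` with the sector ratio substituted. -/
theorem one_sub_sector_fluct {P₁ P₂ A B r : ℝ} (hP : P₂ / P₁ ^ 2 = r) :
    1 - P₂ * B / (P₁ * A) ^ 2 = 1 - r * (B / A ^ 2) := by
  rw [← hP]; ring

/-- **Sector–fluctuation factorisation of the partition function** (finite abelian gauge group, every `β`):
`Z_β(n₀,n₁,n₂,n₃) = Haar(Flat) · Ξ_β`, with the fluctuation sum `Ξ_β = ∑_{ω ∈ P(univ)} exp(−β ∑_{x,q} (n − Re tr ρ(ω(x,q))))` over the achievable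
plaquette fields `P(univ)`. -/
theorem wilsonFinTorusPartition_eq_flat_mul_fluct (β : ℝ) (n₀ n₁ n₂ n₃ : ℕ)
    [DecidableEq (FinTorusSite n₀ n₁ n₂ n₃ × {q : Fin 4 × Fin 4 // q.1 < q.2} → G)] :
    wilsonFinTorusPartition ρ β n₀ n₁ n₂ n₃ =
      (Measure.pi fun _ : FinTorusSite n₀ n₁ n₂ n₃ × Fin 4 => haarProbability G).real
          {U : FinTorusSite n₀ n₁ n₂ n₃ × Fin 4 → G |
            ∀ (x : FinTorusSite n₀ n₁ n₂ n₃) (q : {q : Fin 4 × Fin 4 // q.1 < q.2}),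
              (ρ (finTorusPlaquette U x q.1.1 q.1.2)).trace.re = n} *
        ∑ ω ∈ Finset.univ.image (fun U : FinTorusSite n₀ n₁ n₂ n₃ × Fin 4 → G =>
            fun p : FinTorusSite n₀ n₁ n₂ n₃ × {q : Fin 4 × Fin 4 // q.1 < q.2} => finTorusPlaquette U p.1 p.2.1.1 p.2.1.2),
          Real.exp (-β * ∑ x : FinTorusSite n₀ n₁ n₂ n₃, ∑ q : {q : Fin 4 × Fin 4 // q.1 < q.2},
            ((n : ℝ) - (ρ (ω (x, q))).trace.re)) := by
  classical
  haveI : DiscreteMeasurableSpace G := discreteMeasurableSpace_of_borel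
  have hρc : Continuous ρ := continuous_of_discreteTopology
  -- the integral is a finite sum with equal point masses
  have hint : Integrable (fun U : FinTorusSite n₀ n₁ n₂ n₃ × Fin 4 → G =>
      Real.exp (-β * ∑ x : FinTorusSite n₀ n₁ n₂ n₃, ∑ q : {q : Fin 4 × Fin 4 // q.1 < q.2},
        ((n : ℝ) - (ρ (finTorusPlaquette U x q.1.1 q.1.2)).trace.re)))
      (Measure.pi fun _ : FinTorusSite n₀ n₁ n₂ n₃ × Fin 4 => haarProbability G) :=
    (continuous_weight ρ hρc β n₀ n₁ n₂ n₃).integrable_of_hasCompactSupport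
      (IsCompact.of_isClosed_subset isCompact_univ (isClosed_tsupport _) (Set.subset_univ _))
  unfold wilsonFinTorusPartition
  rw [integral_fintype hint]
  have hpt : ∀ U : FinTorusSite n₀ n₁ n₂ n₃ × Fin 4 → G,
      (Measure.pi fun _ : FinTorusSite n₀ n₁ n₂ n₃ × Fin 4 => haarProbability G).real {U} =
        ((Fintype.card G : ℝ) ^ Fintype.card (FinTorusSite n₀ n₁ n₂ n₃ × Fin 4))⁻¹ := by
    intro U
    rw [measureReal_def, pi_haarProbability_singleton U, ENNReal.toReal_pow, ENNReal.toReal_inv, ENNReal.toReal_natCast, inv_pow]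
  simp only [hpt, smul_eq_mul]
  rw [← Finset.mul_sum]
  -- the fibre identity for the weight of the plaquette field
  have hfib := sum_comp_plaquetteField_eq (n₀ := n₀) (n₁ := n₁) (n₂ := n₂) (n₃ := n₃) (G := G)
    (fun ω => Real.exp (-β * ∑ x : FinTorusSite n₀ n₁ n₂ n₃, ∑ q : {q : Fin 4 × Fin 4 // q.1 < q.2},
      ((n : ℝ) - (ρ (ω (x, q))).trace.re)))
  simp only at hfib
  rw [hfib, ← mul_assoc]
  congr 1
  -- the flat mass: `Haar(Flat_char) = #Flat / |G|^E`
  rw [measureReal_pi_haarProbability_eq_card, div_eq_mul_inv, mul_comm]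
  congr 1
  -- `Nat.card` of the character-flat set = `Finset.card` of the holonomy-flat filter
  rw [Nat.card_eq_fintype_card, Fintype.card_subtype]
  congr 2
  ext W
  simp only [Finset.mem_filter, Finset.mem_univ, true_and, Set.mem_setOf_eq]
  rw [charFlat_iff_flat ρ hρ W, flat_iff_flat_lt]

/-- **THE NUMBER's currency = sector factor × fluctuation ratio** (finite abelian gauge group, identity-detecting character, `L ≥ 4`, every `β`):
`coldDefect ρ β L = 1 − |G|⁻³ · Ξ_β(L³×2⌊L/4⌋) / Ξ_β(L³×⌊L/4⌋)²`. -/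
theorem coldDefect_eq_sector_mul_fluct (β : ℝ) {L : ℕ} (hL : 4 ≤ L)
    [DecidableEq (FinTorusSite L L L (2 * (L / 4)) × {q : Fin 4 × Fin 4 // q.1 < q.2} → G)]
    [DecidableEq (FinTorusSite L L L (L / 4) × {q : Fin 4 × Fin 4 // q.1 < q.2} → G)] :
    coldDefect ρ β L = 1 - ((Fintype.card G : ℝ) ^ 3)⁻¹ *
      ((∑ ω ∈ Finset.univ.image (fun U : FinTorusSite L L L (2 * (L / 4)) × Fin 4 → G =>
            fun p : FinTorusSite L L L (2 * (L / 4)) × {q : Fin 4 × Fin 4 // q.1 < q.2} => finTorusPlaquette U p.1 p.2.1.1 p.2.1.2),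
          Real.exp (-β * ∑ x : FinTorusSite L L L (2 * (L / 4)), ∑ q : {q : Fin 4 × Fin 4 // q.1 < q.2},
            ((n : ℝ) - (ρ (ω (x, q))).trace.re))) /
        (∑ ω ∈ Finset.univ.image (fun U : FinTorusSite L L L (L / 4) × Fin 4 → G =>
            fun p : FinTorusSite L L L (L / 4) × {q : Fin 4 × Fin 4 // q.1 < q.2} => finTorusPlaquette U p.1 p.2.1.1 p.2.1.2),
          Real.exp (-β * ∑ x : FinTorusSite L L L (L / 4), ∑ q : {q : Fin 4 × Fin 4 // q.1 < q.2},
            ((n : ℝ) - (ρ (ω (x, q))).trace.re))) ^ 2) := by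
  have hL0 : 0 < L := by omega
  have hT : 0 < L / 4 := Nat.div_pos hL (by norm_num)
  have hT2 : 0 < 2 * (L / 4) := by omega
  have h2 := wilsonFinTorusPartition_eq_flat_mul_fluct ρ hρ β L L L (2 * (L / 4))
  have h1 := wilsonFinTorusPartition_eq_flat_mul_fluct ρ hρ β L L L (L / 4)
  rw [measureReal_charFlat ρ hρ hL0 hL0 hL0 hT2] at h2
  rw [measureReal_charFlat ρ hρ hL0 hL0 hL0 hT] at h1
  unfold coldDefect
  rw [h1, h2]
  refine one_sub_sector_fluct ?_
  -- the sector ratio `P₂ / P₁² = |G|⁻³`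
  simp only [Fintype.card_prod, Fintype.card_fin]
  have hV : L * (L * (L * (2 * (L / 4)))) = 2 * (L * (L * (L * (L / 4)))) := by ring
  rw [hV]
  set V : ℕ := L * (L * (L * (L / 4))) with hVdef
  have hq : (0 : ℝ) < Fintype.card G := by exact_mod_cast Fintype.card_pos
  set q : ℝ := (Fintype.card G : ℝ) with hqdef
  field_simp
  ring

end Factorisation

end Summit.QuantumFields.YangMills.Cruxes.IR.FreezingLimit

end
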